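import Literature.NumberTheory.EllipticCurves.ZpExtensionEisensteinGradedInvariantsBoundProofs
import Literature.NumberTheory.EllipticCurves.TorsionFilAtCardProofs
import Literature.NumberTheory.EllipticCurves.Greenberg1999.KummerImageGoodOrdinaryNumberField
import Literature.NumberTheory.EllipticCurves.ZpExtensionEisensteinTowerReadoutCurve
import HarnessLib

/-!
# Shifting coboundaries modulo `C_v = E[p^∞] ∩ E₁(K̄_v)` up the torsion levels at a good ordinary place `v ∣ p`
# (proofs file)

Topic `NumberTheory/EllipticCurves` (cell `pub/bsd-print-x9`, shared μ-crux `MuInequalityCoherentPairOfPrintCG`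
stmt-BirchSwinnertonDyer-23428, STUB B letter (B5-P) `Stmt.readoutLocalIndexP`, input hS′ at `v ∣ p` in the
level-shifted currency of the (B5) owner's ruling: the relaxed local condition at `v ∣ p` is the preimage under
`incLocIter … d_v` of «gr-principal on `Gal(K̄_v/K_{∞,w})`» at level `j + d_v`).  Sequel to
`Greenberg1999/KummerImageGoodOrdinaryNumberField` (the Greenberg datum `kernelOfReductionLocalDatum`, `C_v`),
`TorsionFilAtCyclicOrdinaryProofs` / `TorsionFilAtCardProofs` (`E₁(K̄_v)` is `p`-divisible with an ordinary point; its
torsion points are geometric) and `ZpExtensionEisensteinGradedInvariantsBoundProofs` (`exists_int_scalar_torsionFilAt`: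
`Γ_{K_v}` acts on `E[p^k]/Fil_v` by integer scalars).  THEOREMS ONLY: no definition, no named fact, no instance, no `sorry`.

WHY.  A class of `Sel_{p^∞}(E/K_∞)` read out from Howard's `H¹(K, T^{(j)})` is, coordinate by coordinate and after
Greenberg's (CG) at `w ∣ p`, a coboundary MODULO `C_v` on `ker κ ⊓ D_v` of some `q ∈ E[p^∞]/C_v` — but with
`E[p^{j+1}]`-coefficients only up to the boundary of `B̃ = (E[p^∞]/C_v)^{ker κ ⊓ D_v} = Ẽ(k_{∞,w})[p^∞]` (non-zero
exactly in the anomalous case).  This file supplies the uniform exponent `d_v` that absorbs that boundary: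

* §1 (pure algebra) `forall_eq_or_exists_pow_nsmul_fixed_eq_zero`, `exists_forall_coboundary_eq_of_pow_nsmul_eq_zero` —
  for a `p`-primary group exhausted by subgroups `L k` killed by `p^k` on which additive endomorphisms act by integer
  scalars: either all act trivially, or their common fixed points have bounded exponent `p^e`; hence a coboundary with
  `p^k`-torsion values is the coboundary of a `p^{k+e}`-torsion element.
* §2 (the curve) `WeierstrassCurve.exists_mem_plus_pow_nsmul_eq` (`C_v` is `p^n`-divisible inside `E[p^∞]`),
  `exists_int_smul_grMk_eq` (`D_v` acts on the image of `E[p^k]` in `E[p^∞]/C_v` by an integer scalar),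
  **`exists_shift_coboundary_mod_kernelOfReduction`** — `∃ e, ∀ k`: a function `(ker κ ⊓ D_v) → E[p^k]` that is the
  coboundary of a class of `E[p^∞]/C_v` modulo `C_v` is the coboundary of a point of `E[p^{k+e}]` modulo `C_v`.

References: [GreenbergLNM1716] §1 p. 62, §2 Prop. 2.2, Prop. 2.4 (pp. 73–82); [Howard2004HeegnerKolyvagin] §3.1,
Lemma 2.2.7 / Prop. 2.2.8 and proof of Thm. 2.2.10.  BSD is not proved by any of this.
-/

noncomputable section

open scoped Classical

open NumberField IsDedekindDomain Field
open Literature.NumberTheory.EllipticCurves Literature.NumberTheory.GaloisRepresentations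
open Literature.NumberTheory.EllipticCurves.GreenbergSelmer

namespace Literature.NumberTheory.EllipticCurves

/-! ## §1 Pure algebra: a torsion group with a scalar action — either the action is trivial, or the fixed
points have bounded exponent; hence coboundaries can be shifted to bounded torsion level -/

/-- **Dichotomy for a level-wise scalar action on a `p`-primary group.** Let `Q` be an abelian group exhausted by
subgroups `L k` killed by `p^k`, and let additive endomorphisms `act i` act on each `L k` through an integer scalar.
Then either every `act i` is the identity, or there is `e` such that every common fixed point of the `act i` is killed
by `p^e` (the algebra behind «`Ẽ(k_{∞,w})[p^∞]` is finite or everything», Greenberg's local analysis at `v ∣ p`).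
[cite: GreenbergLNM1716, §2 pp. 69–72 and Prop. 2.4 (pp. 79–80)] -/
theorem forall_eq_or_exists_pow_nsmul_fixed_eq_zero {Q : Type*} [AddCommGroup Q] {ι : Type*} (act : ι → Q →+ Q)
    (p : ℕ) [hp : Fact p.Prime] (L : ℕ → AddSubgroup Q) (hL : ∀ k, ∀ q ∈ L k, p ^ k • q = 0)
    (hmono : Monotone L) (hcov : ∀ q, ∃ k, q ∈ L k) (hscalar : ∀ i k, ∃ c : ℤ, ∀ q ∈ L k, act i q = c • q) :
    (∀ i q, act i q = q) ∨ ∃ e : ℕ, ∀ r : Q, (∀ i, act i r = r) → p ^ e • r = 0 := by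
  by_cases htriv : ∀ i q, act i q = q
  · exact Or.inl htriv
  right
  push Not at htriv
  obtain ⟨i₀, q₀, hq₀⟩ := htriv
  obtain ⟨k₀, hk₀⟩ := hcov q₀
  refine ⟨k₀, fun r hr ↦ ?_⟩
  obtain ⟨k₁, hk₁⟩ := hcov r
  -- the scalar of `i₀` on the common level `max k₀ k₁`
  obtain ⟨c, hc⟩ := hscalar i₀ (max k₀ k₁)
  have hq₀' : (c - 1) • q₀ ≠ 0 := by
    intro h
    apply hq₀
    rw [sub_smul, one_smul, sub_eq_zero] at h
    rw [hc q₀ (hmono (le_max_left _ _) hk₀), h]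
  have hr' : (c - 1) • r = 0 := by
    rw [sub_smul, one_smul, sub_eq_zero, ← hc r (hmono (le_max_right _ _) hk₁), hr i₀]
  have hpr : ((p : ℤ) ^ k₁) • r = 0 := by
    rw [← Nat.cast_pow, natCast_zsmul]; exact hL k₁ r hk₁
  have hpq₀ : ((p : ℤ) ^ k₀) • q₀ = 0 := by
    rw [← Nat.cast_pow, natCast_zsmul]; exact hL k₀ q₀ hk₀
  -- `g = gcd (c - 1, p^{k₁}) = p^t` with `t < k₀`
  set g : ℕ := Int.gcd (c - 1) ((p : ℤ) ^ k₁) with hg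
  have hgdvd : g ∣ p ^ k₁ := by
    have h := Int.gcd_dvd_right (c - 1) ((p : ℤ) ^ k₁)
    rw [← hg] at h
    exact_mod_cast h
  obtain ⟨t, _, ht⟩ := (Nat.dvd_prime_pow hp.out).1 hgdvd
  have htk₀ : t < k₀ := by
    by_contra hle
    push Not at hle
    apply hq₀'
    have hdvd : ((p : ℤ) ^ k₀) ∣ (c - 1) := by
      have h1 : (g : ℤ) ∣ (c - 1) := by rw [hg]; exact Int.gcd_dvd_left _ _
      rw [ht, Nat.cast_pow] at h1
      exact (pow_dvd_pow (p : ℤ) hle).trans h1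
    obtain ⟨d, hd⟩ := hdvd
    rw [hd, mul_comm, mul_smul, hpq₀, smul_zero]
  -- Bezout: `g • r = 0`, hence `p^t • r = 0`, hence `p^{k₀} • r = 0`
  have hgr : (g : ℤ) • r = 0 := by
    rw [hg, Int.gcd_eq_gcd_ab (c - 1) ((p : ℤ) ^ k₁), add_smul, mul_comm (c - 1), mul_smul, hr', smul_zero,
      mul_comm ((p : ℤ) ^ k₁), mul_smul, hpr, smul_zero, add_zero]
  rw [ht, Nat.cast_pow, ← Nat.cast_pow, natCast_zsmul] at hgr
  have hk₀t : k₀ = (k₀ - t) + t := (Nat.sub_add_cancel htk₀.le).symm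
  rw [hk₀t, pow_add, mul_smul, hgr, smul_zero]

/-- **Shifting a coboundary to bounded torsion level.** In the situation of
`forall_eq_or_exists_pow_nsmul_fixed_eq_zero` there is `e` (depending only on the action) such that: whenever the
coboundary `i ↦ act i q − q` of an element `q` takes values killed by `p^k`, it is also the coboundary of an element
killed by `p^{k+e}` (the algebra behind the bounded defect of the Kummer classes at `w ∣ p`).
[cite: GreenbergLNM1716, §2 Prop. 2.2 and Prop. 2.4 (pp. 73–80)] -/
theorem exists_forall_coboundary_eq_of_pow_nsmul_eq_zero {Q : Type*} [AddCommGroup Q] {ι : Type*}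
    (act : ι → Q →+ Q) (p : ℕ) [hp : Fact p.Prime] (L : ℕ → AddSubgroup Q) (hL : ∀ k, ∀ q ∈ L k, p ^ k • q = 0)
    (hmono : Monotone L) (hcov : ∀ q, ∃ k, q ∈ L k) (hscalar : ∀ i k, ∃ c : ℤ, ∀ q ∈ L k, act i q = c • q) :
    ∃ e : ℕ, ∀ (k : ℕ) (q : Q), (∀ i, p ^ k • (act i q - q) = 0) →
      ∃ q' : Q, p ^ (k + e) • q' = 0 ∧ ∀ i, act i q' - q' = act i q - q := by
  rcases forall_eq_or_exists_pow_nsmul_fixed_eq_zero act p L hL hmono hcov hscalar with htriv | ⟨e, he⟩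
  · refine ⟨0, fun k q _ ↦ ⟨0, smul_zero _, fun i ↦ ?_⟩⟩
    rw [map_zero, sub_zero, htriv i q, sub_self]
  · refine ⟨e, fun k q hq ↦ ⟨q, ?_, fun _ ↦ rfl⟩⟩
    have hfix : ∀ i, act i (p ^ k • q) = p ^ k • q := fun i ↦ by
      rw [map_nsmul, ← sub_eq_zero, ← smul_sub, hq i]
    rw [add_comm, pow_add, mul_smul, he _ hfix]

/-! ## §2 The curve at a good ordinary `v ∣ p`: coboundaries modulo `C_v = E[p^∞] ∩ E₁(K̄_v)` shift up the torsion levels -/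

end Literature.NumberTheory.EllipticCurves

namespace WeierstrassCurve

open Literature.NumberTheory.EllipticCurves

variable {K : Type} [Field K] [NumberField K] (V : WeierstrassCurve K) [V.IsElliptic] {p : ℕ} [hp : Fact p.Prime]
  (κ : ZpExtension K p) (v : HeightOneSpectrum (𝓞 K))

/-- **`C_v` is `p^n`-divisible inside `E[p^∞]`** at a place `v ∋ p` of good reduction with an ordinary point: every
`c ∈ C_v = E[p^∞] ∩ E₁(K̄_v)` is `p^n • c′` with `c′ ∈ C_v` (`E₁(K̄_v)` is `p`-divisible and its torsion points are
geometric). [cite: GreenbergLNM1716, §1 p. 62 and §2 p. 82 («since 𝓕(𝔪̄) is divisible»)] -/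
theorem exists_mem_plus_pow_nsmul_eq (hgood : V.HasGoodReductionAt v) (hpv : (p : 𝓞 K) ∈ v.asIdeal)
    (hord : ∃ P : localPoints V (v.adicCompletion K), (p : ℤ) • P = 0 ∧ P ∉ V.localKernelOfReduction v) (n : ℕ)
    {c : V.geomPrimaryTorsion p} (hc : c ∈ (V.kernelOfReductionLocalDatum p v).plus) :
    ∃ c' : V.geomPrimaryTorsion p, c' ∈ (V.kernelOfReductionLocalDatum p v).plus ∧ p ^ n • c' = c := by
  -- `p^n`-divide the image `a ∈ E₁(K̄_v)` of `c`
  have hdiv : ∀ (j : ℕ) {a : localPoints V (v.adicCompletion K)}, a ∈ V.localKernelOfReduction v →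
      ∃ b : localPoints V (v.adicCompletion K), b ∈ V.localKernelOfReduction v ∧ p ^ j • b = a := by
    intro j
    induction j with
    | zero => intro a ha; exact ⟨a, ha, by rw [pow_zero, one_smul]⟩
    | succ j ih =>
      intro a ha
      obtain ⟨b, hb, rfl⟩ := ih ha
      obtain ⟨b', hb', rfl⟩ := V.exists_nsmul_eq_of_mem_localKernelOfReduction v hgood hpv hord hb
      exact ⟨b', hb', by rw [pow_succ, mul_smul]⟩
  rw [mem_kernelOfReductionLocalDatum_plus_iff] at hc
  obtain ⟨b, hb, hbc⟩ := hdiv n hc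
  -- `c` is `p`-primary, so `b` is torsion, hence geometric
  obtain ⟨n₀, hn₀⟩ := (AddCommGroup.mem_primaryComponent (G := geomPoints V) (p := p)).1 c.2
  have hbtors : ((p ^ (n + n₀) : ℕ) : ℤ) • b = 0 := by
    rw [natCast_zsmul, pow_add, mul_comm, mul_smul, hbc, ← map_nsmul, hn₀, map_zero]
  obtain ⟨Q, hQ0, hQb⟩ := V.exists_geomTorsion_pointsMapOfEmb_eq v (n + n₀) b hbtors
  have hQprim : Q ∈ V.geomPrimaryTorsion p :=
    (AddCommGroup.mem_primaryComponent (G := geomPoints V) (p := p)).2 ⟨n + n₀, by rwa [natCast_zsmul] at hQ0⟩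
  refine ⟨⟨Q, hQprim⟩, ?_, ?_⟩
  · rw [mem_kernelOfReductionLocalDatum_plus_iff]
    change pointsMapOfEmb V (closureEmb (K := K) (v.adicCompletion K)) Q ∈ _
    rw [hQb]; exact hb
  · apply Subtype.ext
    apply pointsMapOfEmb_injective V (closureEmb (K := K) (v.adicCompletion K))
    change pointsMapOfEmb V _ (p ^ n • Q) = pointsMapOfEmb V _ (c : geomPoints V)
    rw [map_nsmul, hQb, hbc]; rfl

/-- **The decomposition group acts on the images of the `E[p^k]` in `E[p^∞]/C_v` through integer scalars**
(`E[p^k]/Fil_v E[p^k]` is cyclic: `exists_int_scalar_torsionFilAt`).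
[cite: Howard2004HeegnerKolyvagin, §3.1 (arXiv:1202.6340 p. 15 L56–62)] [cite: GreenbergLNM1716, §2 (the action on Ẽ[p^k])] -/
theorem exists_int_smul_grMk_eq (hgood : V.HasGoodReductionAt v) (hpv : (p : 𝓞 K) ∈ v.asIdeal)
    (hord : ∃ P : localPoints V (v.adicCompletion K), (p : ℤ) • P = 0 ∧ P ∉ V.localKernelOfReduction v)
    (δ : decomp (K := K) v) (k : ℕ) :
    ∃ c : ℤ, ∀ q ∈ ((V.kernelOfReductionLocalDatum p v).grMk.comp
        (AddSubgroup.inclusion (AcSigned.geomTorsion_zpow_le_geomPrimaryTorsion V p k))).range,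
      δ • q = c • q := by
  obtain ⟨σ₀, hσ₀⟩ := (mem_decomp_iff v _).1 δ.2
  -- scalar at level `k + 1 ≥ 1`, restricted to level `k`
  obtain ⟨n₀, -, -, hn₀, -⟩ := V.exists_int_scalar_torsionFilAt v hgood hpv hord (Nat.le_add_left 1 k) σ₀
  refine ⟨n₀, ?_⟩
  rintro _ ⟨a, rfl⟩
  set a' : geomTorsion V ((p : ℤ) ^ (k + 1)) :=
    AddSubgroup.inclusion (geomTorsion_le_of_dvd V (pow_dvd_pow (p : ℤ) (Nat.le_succ k))) a with ha'
  have hincl : AddSubgroup.inclusion (AcSigned.geomTorsion_zpow_le_geomPrimaryTorsion V p k) a =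
      AddSubgroup.inclusion (AcSigned.geomTorsion_zpow_le_geomPrimaryTorsion V p (k + 1)) a' := rfl
  rw [AddMonoidHom.comp_apply, hincl, LocalDatum.smul_grMk, ← hσ₀, ← sub_eq_zero, ← map_zsmul, ← map_sub,
    ← AddMonoidHom.mem_ker, LocalDatum.ker_grMk, mem_kernelOfReductionLocalDatum_plus_iff]
  have h := hn₀ a'
  rw [mem_torsionFilAt_iff] at h
  exact h

/-- **Shifting coboundaries modulo `C_v` up the levels.** At a place `v ∋ p` of good reduction with an ordinary point
there is `e : ℕ` (depending only on `E`, `v` and the `ℤ_p`-extension `κ`) such that, for every `k`: if a function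
`f : (ker κ ⊓ D_v) → E[p^k]` is, modulo `C_v`, the coboundary of some class `q ∈ E[p^∞]/C_v`, then it is, modulo `C_v`,
the coboundary of a point `q̂ ∈ E[p^{k+e}]`.  (Dichotomy: either `ker κ ⊓ D_v` acts trivially on `E[p^∞]/C_v`, or its
fixed points there have bounded exponent `p^e`, and `p^k • q` is fixed; then divide inside `C_v`.)
[cite: GreenbergLNM1716, §2 Prop. 2.2 and Prop. 2.4 (pp. 73–80)] [cite: Howard2004HeegnerKolyvagin, Lemma 2.2.7 / Prop. 2.2.8] -/
theorem exists_shift_coboundary_mod_kernelOfReduction (hgood : V.HasGoodReductionAt v) (hpv : (p : 𝓞 K) ∈ v.asIdeal)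
    (hord : ∃ P : localPoints V (v.adicCompletion K), (p : ℤ) • P = 0 ∧ P ∉ V.localKernelOfReduction v) :
    ∃ e : ℕ, ∀ (k : ℕ) (f : decompIn κ.kerSubgroup v → geomTorsion V ((p : ℤ) ^ k))
      (q : (V.kernelOfReductionLocalDatum p v).Gr),
      (∀ y, (V.kernelOfReductionLocalDatum p v).grMk
          (AddSubgroup.inclusion (AcSigned.geomTorsion_zpow_le_geomPrimaryTorsion V p k) (f y)) = y • q - q) →
      ∃ qhat : geomTorsion V ((p : ℤ) ^ (k + e)), ∀ y : decompIn κ.kerSubgroup v,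
        AddSubgroup.inclusion (AcSigned.geomTorsion_zpow_le_geomPrimaryTorsion V p k) (f y) -
          ((((y : decomp (K := K) v) : absoluteGaloisGroup K) •
              AddSubgroup.inclusion (AcSigned.geomTorsion_zpow_le_geomPrimaryTorsion V p (k + e)) qhat) -
            AddSubgroup.inclusion (AcSigned.geomTorsion_zpow_le_geomPrimaryTorsion V p (k + e)) qhat) ∈
          (V.kernelOfReductionLocalDatum p v).plus := by
  set N := V.kernelOfReductionLocalDatum p v with hN
  -- the levels `L k = image of E[p^k]` in `E[p^∞]/C_v` and the action of `ker κ ⊓ D_v`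
  set L : ℕ → AddSubgroup N.Gr := fun k ↦
    (N.grMk.comp (AddSubgroup.inclusion (AcSigned.geomTorsion_zpow_le_geomPrimaryTorsion V p k))).range with hL
  set act : decompIn κ.kerSubgroup v → N.Gr →+ N.Gr := fun y ↦
    DistribSMul.toAddMonoidHom N.Gr (y : decomp (K := K) v) with hact
  have hLk : ∀ k, ∀ q ∈ L k, p ^ k • q = 0 := by
    rintro k _ ⟨a, rfl⟩
    rw [← map_nsmul, V.geomTorsion_pow_nsmul_eq_zero p k a, map_zero]
  have hmono : Monotone L := by
    refine monotone_nat_of_le_succ fun k ↦ ?_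
    rintro _ ⟨a, rfl⟩
    exact ⟨AddSubgroup.inclusion (geomTorsion_le_of_dvd V (pow_dvd_pow (p : ℤ) (Nat.le_succ k))) a, rfl⟩
  have hcov : ∀ q, ∃ k, q ∈ L k := by
    intro q
    obtain ⟨P, rfl⟩ := N.grMk_surjective q
    obtain ⟨n, hn⟩ := (AddCommGroup.mem_primaryComponent (G := geomPoints V) (p := p)).1 P.2
    refine ⟨n, ⟨⟨(P : geomPoints V), ?_⟩, rfl⟩⟩
    rw [mem_geomTorsion_iff, ← Nat.cast_pow, natCast_zsmul, hn]
  have hscalar : ∀ y k, ∃ c : ℤ, ∀ q ∈ L k, act y q = c • q := fun y k ↦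
    V.exists_int_smul_grMk_eq v hgood hpv hord (y : decomp (K := K) v) k
  obtain ⟨e, he⟩ := exists_forall_coboundary_eq_of_pow_nsmul_eq_zero act p L hLk hmono hcov hscalar
  refine ⟨e, fun k f q hq ↦ ?_⟩
  -- the values of the coboundary are killed by `p^k`
  have hval : ∀ y, p ^ k • (act y q - q) = 0 := fun y ↦ by
    have h : act y q - q = N.grMk (AddSubgroup.inclusion (AcSigned.geomTorsion_zpow_le_geomPrimaryTorsion V p k) (f y)) :=
      (hq y).symm
    rw [h, ← map_nsmul, ← map_nsmul, V.geomTorsion_pow_nsmul_eq_zero p k (f y), map_zero, map_zero]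
  obtain ⟨q', hq', hcob⟩ := he k q hval
  -- lift `q'` to a point `P ∈ E[p^∞]` and correct it inside `C_v`
  obtain ⟨P, rfl⟩ := N.grMk_surjective q'
  have hPker : p ^ (k + e) • P ∈ N.plus := by
    rw [← LocalDatum.ker_grMk, AddMonoidHom.mem_ker, map_nsmul, hq']
  obtain ⟨c', hc', hc'P⟩ := V.exists_mem_plus_pow_nsmul_eq v hgood hpv hord (k + e) hPker
  have hmem : ((P - c' : V.geomPrimaryTorsion p) : geomPoints V) ∈ geomTorsion V ((p : ℤ) ^ (k + e)) := by
    rw [mem_geomTorsion_iff, ← Nat.cast_pow, natCast_zsmul, AddSubgroupClass.coe_sub, smul_sub, sub_eq_zero,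
      ← AddSubgroupClass.coe_nsmul, ← AddSubgroupClass.coe_nsmul, hc'P]
  refine ⟨⟨((P - c' : V.geomPrimaryTorsion p) : geomPoints V), hmem⟩, fun y ↦ ?_⟩
  have hincl : AddSubgroup.inclusion (AcSigned.geomTorsion_zpow_le_geomPrimaryTorsion V p (k + e))
      ⟨((P - c' : V.geomPrimaryTorsion p) : geomPoints V), hmem⟩ = P - c' := rfl
  have hc'0 : N.grMk c' = 0 := by rw [← AddMonoidHom.mem_ker, LocalDatum.ker_grMk]; exact hc'
  have h : (y : decomp (K := K) v) • N.grMk P - N.grMk P = (y : decomp (K := K) v) • q - q := hcob y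
  rw [hincl, ← LocalDatum.ker_grMk, AddMonoidHom.mem_ker, map_sub, map_sub, hq y, ← LocalDatum.smul_grMk, map_sub,
    hc'0, sub_zero]
  change (y : decomp (K := K) v) • q - q - ((y : decomp (K := K) v) • N.grMk P - N.grMk P) = 0
  rw [h, sub_self]

end WeierstrassCurve

end
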